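import Summits.QuantumFields.YangMills.Theorems.BalabanUVNodesN15VectorPieceReadoutFull
import Literature.MathematicalPhysics.QuantumFieldTheory.BalabanImbrieJaffe1984to88.BIJ85Eq721MinimizerKernel
import Literature.MathematicalPhysics.QuantumFieldTheory.Balaban1983to89.B6Cov2156TorusDelK
import HarnessLib

/-!
# Route «BalabanUVNodes» (K4 «SpineRates»), node N15 = NE2, -a lane, part 24: THE TYPED KERNELS OF THE VECTOR PIECE ARE REAL —
# `H_k`, `∂_νH_k`, `(Δ−∂∂*)H_k` (and `Δ_k`) have vanishing imaginary parts, so the real-part readout of parts 15–23 IS the readout of the operators —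
# AND THE GUARD-FREE (3.42) CONTENT of that readout, by name (the two referee pins on the -a chain answered in kernel)

Cell `pub-ymgap`, seat `pub-ymgap-dag-n15-a` (KNIT-BY-NAME, generation g5; HUMAN RULING D-0062; chair R424 venue; `bears_on: R4∕N15`).  Filed
`--supports stmt-QuantumFields-19351` (helper).  THEOREMS ONLY; imports BY NAME, nothing in the tree modified: part 23 (`reLap`; transitively part 15:
`reH`, `reD`), pv15-g3's reality module `B5RealFields` (`IsReal A :⇔ ∀ i j, conj (A i j) = A i j`, its closure under `+ − • * ᴴ ⁻¹`, `reM`, `cplx`,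
`IsReal.cplx_mulVec`, `IsReal.map_ofReal_reM`, and the reality of EVERY Sect. C operator: `isReal_fdiff`, `isReal_sdiff`, `isReal_GradOp`, `isReal_Lap`,
`isReal_PcT`, `isReal_DeltaA_inv`), the BIJ lineage's `BIJ85Eq721MinimizerKernel` §1 (**`isReal_HkOp`** — the (1.63) torus operator is real, via
`B5Hk163Form166.HkOp_eq_Hk` + `isReal_Hk` ∕ `isReal_QGQ` ∕ `isReal_calG`; CITED, not re-proved: the gate's dedup named it), `B6Cov2156TorusDelK` §5 v1.1
(`isReal_DelK`, `im_DelK_eq_zero`).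

WHY (two referee pins).  (A) dag-ref-B g8 READ-329 (pub-ymgap INBOX l.11734, 2026-08-26T11:06Z), PIN «Im Δ_k»: «the four-factor assembly `Q_kᴴ·(n^dΔ_k)·C^{(k)}·(η^{d+1}H_kᵀ)`
mixes the COMPLEX `DelK` (part 18's identity) with the REAL `deltaPol` (`bondReductionT`), so it needs `(DelK n hn M a ha i j).im = 0` BY NAME … or a bound on the
imaginary part».  Two facts answer it.  (1) The literal ask IS a tree theorem: `B6Cov2156TorusDelK.im_DelK_eq_zero` (from `isReal_DelK`).  (2) Parts 15–23 read the
(3.42) entries through `reH`∕`reD`∕`reLap := Matrix.mulVecLin ((…).map Complex.reLm)` — the REAL PARTS of the typed complex kernels `HkOp n M`,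
`fdiff … ν * HkOp n M`, `DstarD n M * HkOp n M` (every kernel statement there is correct as typed: `re_lapker_bpt` goes through `QvOp_im_eq_zero` and
`re_DelK_eq_deltaPol`).  THIS FILE proves those three kernels ARE REAL (§1), so the real-part matrices, read back in `ℂ`, ARE the typed operators and the real
linear maps `reH`, `reD ν`, `reLap` are the typed operators restricted to real 1-forms (§2) — the readout of parts 17∕23 (`ne2ZeroOperator_vec`, `ne2PlusOperator_vec`)
is about Bałaban's `H_k`, `∂_νH_k`, `(Δ−∂∂*)H_k` themselves, not about a real-part surrogate.  [B5] p.18 works with real fields («Thus A are functions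
A : {b ⊂ T_ε} → ℝ», quoted in `B5RealFields`); the complex typing of the b05 lineage is a Fourier-analysis convenience.
(B) dag-ref-B g7 READ-323 (INBOX l.11681), A2 «VACUOUS AS TYPED»: `T4EtaRate.NE2ZeroOperator`∕`NE2PlusOperator` begin `∃ M₅ …, ∀ i, M₅ ≤ (pi i).gf.M → …`
and every realised geometry of the vector piece has `M = 1` (`unitTorusGeo.M := 1`), so the BY-NAME conclusions of parts 17∕23 are provable with NO estimate
(witness `M₅ = 2`, referee probe rc 0); ASK (i): state `∃ δ₀ B γ₀ > 0, ∀ i, EtaRateIneq342 (vecFamily hL T3 i) B δ₀ γ₀ ()` — what the proofs show.  §3 does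
exactly that for the four CONCRETE entries (T3 := part 23's `entry3`): `etaRateIneq342_vec_all` (+ `_dim4`).

CONTENTS (all `theorem`, all algebra over the typed definitions — no estimate, nothing printed is asserted).
* §1 `im_HkOp_eq_zero`, `im_hker_eq_zero` (from the cited `isReal_HkOp`); `isReal_CurlOp`, `isReal_Kop`, **`isReal_DstarD`** (`Δ − ∂∂* = Lap − GradOp·GradOpᴴ`),
  **`isReal_fdiff_mul_HkOp`**, `im_fdiff_HkOp_eq_zero`, **`isReal_DstarD_mul_HkOp`**, `im_DstarD_HkOp_eq_zero`; capstone `vectorPiece_factors_isReal`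
  (`H_k`, all `∂_νH_k`, `(Δ−∂∂*)H_k`, `Δ_k` are `IsReal`).
* §2 `reH_eq_mulVecLin_reM` ∕ `reD_…` ∕ `reLap_…` (the part-15∕23 maps are `mulVecLin (reM …)`), **`map_ofReal_reM_HkOp`** ∕ `map_ofReal_reM_fdiff_HkOp` ∕
  `map_ofReal_reM_DstarD_HkOp` (`(reM X).map (↑) = X` for the three kernels), **`cplx_reH`** ∕ `cplx_reD` ∕ `cplx_reLap`
  (`((reH M n f) : ℂ-valued) = H_k *ᵥ (f : ℂ-valued)` etc.: the real maps are the typed operators on real 1-forms), `ofReal_reH_single` ∕ `…reD…` ∕ `…reLap…`;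
  dag-ref-B READ-333's precision ask as lemmas: **`reLap_eq_reM_DstarD_comp_reH`** (`reLap = (Re(Δ−∂∂*)) ∘ reH`), `reD_eq_reM_fdiff_comp_reH`, `map_ofReal_reM_DstarD`.
* §3 **`etaRateIneq342_vec_all`**: `∃ B δ₀ γ₀ > 0, ∀ i : VecIndex d L, EtaRateIneq342 (vecFamily hL (fun i => entry3 L i.k i.m i.Mn) i) B δ₀ γ₀ ()` —
  the uniform (3.42) inequality for EVERY realised index, no `M₅ ≤ M` guard (from part 16 `hasMaj_threeEntries` at `α = γ = ½`, part 23 `hasMaj_entry3`,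
  part 17 `etaRateIneq342_vec`; `γ₀ = ¼`, `δ₀ = min`, `B = max`); `etaRateIneq342_vec_all_dim4`.

HONEST FRAMING ∕ LIMITS.  §1–§2: finite-dimensional linear algebra over kernel theorems of the b05∕pv15∕β∕BIJ lineages; §3: a re-packaging of parts 16∕17∕23's
estimates with the size guard removed (no new estimate).  `U = 1` LINEAR theory on FINITE tori, one single-scale piece in King's (4.42) shape; [B9]'s size
parameter `M` has no role in this model (said in part 17; here the content is stated without it); NOT the multiscale carrier ∕ telescoping over `j` (NODE 00).  Count-neutral (typed 28∕28 · discharged unchanged); NOT a discharge of N15; NE2⁺ proper (U ≠ 1) NOT PRINTED ∕ not proved; one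
finite T⁴ at fixed ε — NOT infinite volume, NOT OS on ℝ⁴, NOT a mass gap, NOT Clay.
-/

noncomputable section

open scoped BigOperators Matrix ComplexConjugate
open Finset Complex

namespace Summit.QuantumFields.YangMills.BalabanUVNodes.N15.VectorPiece

open Literature.MathematicalPhysics.QuantumFieldTheory.Balaban1983to89
open Literature.MathematicalPhysics.QuantumFieldTheory.Balaban1983to89.B5RealFields (IsReal reM cplx isReal_fdiff isReal_sdiff isReal_GradOp
  isReal_Lap isReal_PcT)
open Literature.MathematicalPhysics.QuantumFieldTheory.Balaban1983to89.B5Prop11Plancherel (Tor fine fdiff)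
open Literature.MathematicalPhysics.QuantumFieldTheory.Balaban1983to89.B5Action121 (GradOp CurlOp sdiff)
open Literature.MathematicalPhysics.QuantumFieldTheory.Balaban1983to89.B5Prop11Lower (Lap)
open Literature.MathematicalPhysics.QuantumFieldTheory.Balaban1983to89.B5Value126 (PcT)
open Literature.MathematicalPhysics.QuantumFieldTheory.Balaban1983to89.B5Hk163Torus (HkOp hker)
open Literature.MathematicalPhysics.QuantumFieldTheory.Balaban1983to89.B5Hk163RDiv (DstarD)
open Literature.MathematicalPhysics.QuantumFieldTheory.Balaban1983to89.Beta.BlockEffectiveAction (DelK Kop)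
open Literature.MathematicalPhysics.QuantumFieldTheory.Balaban1983to89.B6Cov2156TorusDelK (isReal_DelK)
open Literature.MathematicalPhysics.QuantumFieldTheory.BalabanImbrieJaffe1984to88.BIJ85Eq721MinimizerKernel (isReal_HkOp)

variable {d : ℕ}

/-! ## §1 The minimiser `H_k`, its derivatives and its Laplacian are REAL operators -/

section Literature

variable (n : ℕ) [NeZero n] (hn : 1 ≤ n) (M : Fin d → ℕ) [hM : ∀ μ, NeZero (M μ)] (a : ℝ) (ha : 0 < a)

omit [NeZero n] in
/-- the real lattice factor `η⁻¹ = n` is self-conjugate. [folklore] -/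
theorem conj_natCast_lattice : conj ((n : ℕ) : ℂ) = (n : ℂ) := map_natCast _ n

/-- `Im H_k((x′,μ),(y,λ)) = 0` — the (1.63) torus operator is real (`BIJ85Eq721MinimizerKernel.isReal_HkOp`: `H_k = GQ*(QGQ*)⁻¹` (1.103) with
`G = Δ_a⁻¹`, `Q*`, `(QGQ*)⁻¹` real). [cite: Balaban1984PropagatorsI, (1.63) p.28, (1.103) p.34 (typed reading)] -/
theorem im_HkOp_eq_zero (i : Tor (fine n M) × Fin d) (b : Tor M × Fin d) : (HkOp n M i b).im = 0 :=
  (isReal_HkOp n M).im_eq_zero i b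

/-- `Im hker μ λ x′ y = 0` — the position-space kernel of (1.63) is real. [folklore] -/
theorem im_hker_eq_zero (μ lam : Fin d) (x : Tor (fine n M)) (y : Tor M) : (hker n M μ lam x y).im = 0 :=
  im_HkOp_eq_zero n M (x, μ) (y, lam)

omit hM in
/-- the plaquette differential `∂` of (1.2) (`CurlOp`, entries `±` forward differences) is real for a real lattice factor.
[cite: Balaban1984PropagatorsI, (1.2) p.18 (typed reading)] -/
theorem isReal_CurlOp (N : Fin d → ℕ) [∀ μ, NeZero (N μ)] {c : ℂ} (hc : conj c = c) : IsReal (CurlOp N c) := fun i j => by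
  unfold CurlOp
  rw [map_sub]
  congr 1
  · split_ifs
    · exact isReal_sdiff N hc i.2.1 i.1 j.1
    · exact map_zero _
  · split_ifs
    · exact isReal_sdiff N hc i.2.2 i.1 j.1
    · exact map_zero _

/-- the `a`-free part `K = ½(CurlOp)ᴴCurlOp + ∂(1−P)∂ᴴ` of (1.69) is real. [cite: Balaban1984PropagatorsI, (1.69) p.29 (typed reading)] -/
theorem isReal_Kop : IsReal (Kop n M) := by
  have hc := conj_natCast_lattice n
  have h2 : conj (1 / 2 : ℂ) = 1 / 2 := by rw [map_div₀, map_one, map_ofNat]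
  unfold Kop
  exact (IsReal.smul h2 ((isReal_CurlOp (fine n M) hc).conjTranspose.mul (isReal_CurlOp (fine n M) hc))).add
    ((((isReal_GradOp (fine n M) hc).mul (IsReal.one.sub (isReal_PcT n M hc))).mul (isReal_GradOp (fine n M) hc).conjTranspose))

/-- **`Δ − ∂∂* = Lap − GradOp·GradOpᴴ` ((1.69), the gauge-fixed Laplacian of [B5] Sect. D) is real.**
[cite: Balaban1984PropagatorsI, (1.21) p.21, (1.69) p.29 (typed reading)] -/
theorem isReal_DstarD : IsReal (DstarD n M) := by
  have hc := conj_natCast_lattice n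
  unfold DstarD
  exact (isReal_Lap n M).sub ((isReal_GradOp (fine n M) hc).mul (isReal_GradOp (fine n M) hc).conjTranspose)

/-- **`∂_νH_k` (the fine forward difference quotient of (1.63)) is real.** [cite: Balaban1984PropagatorsI, (1.63) p.28, (1.31) p.23 (typed reading)] -/
theorem isReal_fdiff_mul_HkOp (ν : Fin d) : IsReal (fdiff (fine n M) ((n : ℕ) : ℂ) ν * HkOp n M) :=
  (isReal_fdiff (fine n M) (conj_natCast_lattice n) ν).mul (isReal_HkOp n M)

/-- `Im (∂_νH_k)((x′,μ),(y,λ)) = 0`. [folklore] -/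
theorem im_fdiff_HkOp_eq_zero (ν : Fin d) (i : Tor (fine n M) × Fin d) (b : Tor M × Fin d) :
    ((fdiff (fine n M) ((n : ℕ) : ℂ) ν * HkOp n M) i b).im = 0 :=
  (isReal_fdiff_mul_HkOp n M ν).im_eq_zero i b

/-- **`(Δ−∂∂*)H_k` (the fourth-entry factor of parts 21–23) is real.** [cite: Balaban1984PropagatorsI, (1.63) p.28, (1.69) p.29 (typed reading)] -/
theorem isReal_DstarD_mul_HkOp : IsReal (DstarD n M * HkOp n M) :=
  (isReal_DstarD n M).mul (isReal_HkOp n M)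

/-- `Im ((Δ−∂∂*)H_k)((x′,μ),(y,λ)) = 0`. [folklore] -/
theorem im_DstarD_HkOp_eq_zero (i : Tor (fine n M) × Fin d) (b : Tor M × Fin d) : ((DstarD n M * HkOp n M) i b).im = 0 :=
  (isReal_DstarD_mul_HkOp n M).im_eq_zero i b

/-- CAPSTONE FOR THE REFEREE: **all four left factors of the (3.42) entries of the vector single-scale piece are REAL typed operators** —
`H_k` (entry 0 and the adjoint factors), every `∂_νH_k` (entries 1–2), `(Δ−∂∂*)H_k` (entry 3), and the (1.65) effective action `Δ_k` behind entry 3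
(`B6Cov2156TorusDelK.isReal_DelK`, cited). [cite: Balaban1984PropagatorsI, Sect. A p.18 («A : {b ⊂ T_ε} → ℝ»), (1.63) p.28, (1.65) p.29 (typed reading)] -/
theorem vectorPiece_factors_isReal :
    IsReal (HkOp n M) ∧ (∀ ν, IsReal (fdiff (fine n M) ((n : ℕ) : ℂ) ν * HkOp n M)) ∧ IsReal (DstarD n M * HkOp n M)
      ∧ IsReal (DelK n hn M a ha) :=
  ⟨isReal_HkOp n M, isReal_fdiff_mul_HkOp n M, isReal_DstarD_mul_HkOp n M, isReal_DelK n hn M a ha⟩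

end Literature

/-! ## §2 The real-part readout of parts 15–23 IS the readout of the typed operators -/

section Readout

variable (M : Fin (d + 1) → ℕ) [hM : ∀ μ, NeZero (M μ)] (n : ℕ) [NeZero n]

/-- part 15's `reH` is `mulVecLin` of the entrywise real part `reM H_k`. [folklore] -/
theorem reH_eq_mulVecLin_reM : reH M n = Matrix.mulVecLin (reM (HkOp n M)) := rfl

/-- part 15's `reD ν` is `mulVecLin` of `reM (∂_νH_k)`. [folklore] -/
theorem reD_eq_mulVecLin_reM (ν : Fin (d + 1)) : reD M n ν = Matrix.mulVecLin (reM (fdiff (fine n M) ((n : ℕ) : ℂ) ν * HkOp n M)) := rfl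

/-- part 23's `reLap` is `mulVecLin` of `reM ((Δ−∂∂*)H_k)`. [folklore] -/
theorem reLap_eq_mulVecLin_reM : reLap M n = Matrix.mulVecLin (reM (DstarD n M * HkOp n M)) := rfl

/-- dag-ref-B READ-333's precision ask, as a lemma: **`reD ν = (Re ∇_ν) ∘ reH`** — the real part of the product is the product of the real parts
BECAUSE both factors are real (`B5RealFields.IsReal.reM_mul`). [folklore] -/
theorem reD_eq_reM_fdiff_comp_reH (ν : Fin (d + 1)) :
    reD M n ν = Matrix.mulVecLin (reM (fdiff (fine n M) ((n : ℕ) : ℂ) ν)) ∘ₗ reH M n := by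
  rw [reD_eq_mulVecLin_reM, reH_eq_mulVecLin_reM, ← Matrix.mulVecLin_mul,
    (isReal_fdiff (fine n M) (conj_natCast_lattice n) ν).reM_mul (isReal_HkOp n M)]

/-- dag-ref-B READ-333's precision ask, as a lemma: **`reLap = (Re (Δ−∂∂*)) ∘ reH`**, i.e. `Re((Δ−∂∂*)·H_k) = (Δ−∂∂*)_re · Re H_k` BECAUSE `Δ−∂∂*`
(`isReal_DstarD`) and `H_k` (`isReal_HkOp`) are real. [folklore] -/
theorem reLap_eq_reM_DstarD_comp_reH : reLap M n = Matrix.mulVecLin (reM (DstarD n M)) ∘ₗ reH M n := by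
  rw [reLap_eq_mulVecLin_reM, reH_eq_mulVecLin_reM, ← Matrix.mulVecLin_mul, (isReal_DstarD n M).reM_mul (isReal_HkOp n M)]

/-- … and the real matrix `Re (Δ−∂∂*)` read back in `ℂ` IS `Δ−∂∂*`. [folklore] -/
theorem map_ofReal_reM_DstarD : (reM (DstarD n M)).map ((↑) : ℝ → ℂ) = DstarD n M :=
  (isReal_DstarD n M).map_ofReal_reM

/-- **`(Re H_k : ℝ-matrix)` read back in `ℂ` IS `H_k`.** [folklore] -/
theorem map_ofReal_reM_HkOp : (reM (HkOp n M)).map ((↑) : ℝ → ℂ) = HkOp n M :=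
  (isReal_HkOp n M).map_ofReal_reM

/-- `(Re ∂_νH_k)` read back in `ℂ` IS `∂_νH_k`. [folklore] -/
theorem map_ofReal_reM_fdiff_HkOp (ν : Fin (d + 1)) :
    (reM (fdiff (fine n M) ((n : ℕ) : ℂ) ν * HkOp n M)).map ((↑) : ℝ → ℂ) = fdiff (fine n M) ((n : ℕ) : ℂ) ν * HkOp n M :=
  (isReal_fdiff_mul_HkOp n M ν).map_ofReal_reM

/-- `(Re (Δ−∂∂*)H_k)` read back in `ℂ` IS `(Δ−∂∂*)H_k`. [folklore] -/
theorem map_ofReal_reM_DstarD_HkOp : (reM (DstarD n M * HkOp n M)).map ((↑) : ℝ → ℂ) = DstarD n M * HkOp n M :=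
  (isReal_DstarD_mul_HkOp n M).map_ofReal_reM

/-- **`reH` IS `H_k` ON REAL 1-FORMS**: the complexification of `reH M n f` is `H_k *ᵥ (f : ℂ)`. [cite: Balaban1984PropagatorsI, (1.63) p.28, Sect. A p.18 (real fields)] -/
theorem cplx_reH (f : Tor M × Fin (d + 1) → ℝ) : cplx (reH M n f) = HkOp n M *ᵥ cplx f := by
  rw [reH_eq_mulVecLin_reM, Matrix.mulVecLin_apply]
  exact (isReal_HkOp n M).cplx_mulVec f

/-- `reD ν` IS `∂_νH_k` on real 1-forms. [cite: Balaban1984PropagatorsI, (1.63) p.28, (1.31) p.23, Sect. A p.18 (real fields)] -/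
theorem cplx_reD (ν : Fin (d + 1)) (f : Tor M × Fin (d + 1) → ℝ) :
    cplx (reD M n ν f) = (fdiff (fine n M) ((n : ℕ) : ℂ) ν * HkOp n M) *ᵥ cplx f := by
  rw [reD_eq_mulVecLin_reM, Matrix.mulVecLin_apply]
  exact (isReal_fdiff_mul_HkOp n M ν).cplx_mulVec f

/-- `reLap` IS `(Δ−∂∂*)H_k` on real 1-forms. [cite: Balaban1984PropagatorsI, (1.63) p.28, (1.69) p.29, Sect. A p.18 (real fields)] -/
theorem cplx_reLap (f : Tor M × Fin (d + 1) → ℝ) : cplx (reLap M n f) = (DstarD n M * HkOp n M) *ᵥ cplx f := by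
  rw [reLap_eq_mulVecLin_reM, Matrix.mulVecLin_apply]
  exact (isReal_DstarD_mul_HkOp n M).cplx_mulVec f

/-- entries: `reH M n (δ_b) i = H_k(i, b)` as a complex number (no real part lost). [folklore] -/
theorem ofReal_reH_single (b : Tor M × Fin (d + 1)) (i : Tor (fine n M) × Fin (d + 1)) :
    ((reH M n (Pi.single b 1) i : ℝ) : ℂ) = HkOp n M i b := by
  rw [reH_single]
  exact (isReal_HkOp n M).coe_reM i b

/-- entries: `reD M n ν (δ_b) i = (∂_νH_k)(i, b)` as a complex number. [folklore] -/
theorem ofReal_reD_single (ν : Fin (d + 1)) (b : Tor M × Fin (d + 1)) (i : Tor (fine n M) × Fin (d + 1)) :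
    ((reD M n ν (Pi.single b 1) i : ℝ) : ℂ) = (fdiff (fine n M) ((n : ℕ) : ℂ) ν * HkOp n M) i b := by
  rw [reD_single]
  exact (isReal_fdiff_mul_HkOp n M ν).coe_reM i b

/-- entries: `reLap M n (δ_b) i = ((Δ−∂∂*)H_k)(i, b)` as a complex number. [folklore] -/
theorem ofReal_reLap_single (b : Tor M × Fin (d + 1)) (i : Tor (fine n M) × Fin (d + 1)) :
    ((reLap M n (Pi.single b 1) i : ℝ) : ℂ) = (DstarD n M * HkOp n M) i b := by
  rw [reLap_single]
  exact (isReal_DstarD_mul_HkOp n M).coe_reM i b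

end Readout

/-! ## §3 The GUARD-FREE (3.42) content of the four-entry readout (ref-B READ-323, A2 «vacuous as typed») -/

section Content

open Literature.MathematicalPhysics.QuantumFieldTheory.Balaban1983to89.B11SectG (BlockNorm HasMaj)
open Literature.MathematicalPhysics.QuantumFieldTheory.Balaban1983to89.T4EtaRate (EtaRateIneq342)
open Literature.MathematicalPhysics.QuantumFieldTheory.Balaban1983to89.B6UnitTorusCarrier (unitTorusGeo)
open Literature.MathematicalPhysics.QuantumFieldTheory.King1986.Torus (tdistT tdistT_nonneg)

/-- **THE GUARD-FREE CONTENT OF THE FOUR-ENTRY READOUT.**  For `d + 1 ≥ 2`, `L ≥ 1` there are `B, δ₀, γ₀ > 0` such that for EVERY realised index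
`i` (every unit torus `Π ℤ∕M_ν` with `L ∣ M_ν`, all `k`, `m ≥ 1`, every direction `ν`) the realised kernel family of the vector single-scale piece with
the four CONCRETE entries `![entry0, entry1 ν, entry2 ν, entry3]` satisfies `T4EtaRate.EtaRateIneq342 … B δ₀ γ₀` at the (unique) configuration —
NO size guard `M₅ ≤ M`.  This is what the proofs of part 17∕23's `ne2ZeroOperator_vec(_of_entry3)` show; dag-ref-B READ-323 (A2) observed that the
BY-NAME conclusions `NE2ZeroOperator`∕`NE2PlusOperator` are vacuous on this `M ≡ 1` family (witness `M₅ = 2`), so the content is stated here by name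
(the referee's option (i)).  Rate exponent `γ₀ = 1∕4` (entries 0–2 at `α = γ = ½`; entry 3 has the full `(L^k)⁻¹`).
[cite: Balaban1985BackgroundPropagators, Thm 3.1 (3.42) p.397 (shape); King1986, Props. 3.8–3.9 (3.71)–(3.75) pp.664–665 (A = 0 model)] -/
theorem etaRateIneq342_vec_all (hd : 1 ≤ d) {L : ℕ} [NeZero L] (hL : 1 ≤ L) :
    ∃ B δ₀ γ₀ : ℝ, 0 < B ∧ 0 < δ₀ ∧ 0 < γ₀ ∧ ∀ i : VecIndex d L,
      EtaRateIneq342 (vecFamily hL (fun i : VecIndex d L => entry3 (d := d) L i.k i.m i.Mn) i) B δ₀ γ₀ () := by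
  obtain ⟨B, δ₀, hB, hδ₀, H⟩ := hasMaj_threeEntries (d := d) hd hL (α := 1 / 2) (γ := 1 / 2) (by norm_num) (by norm_num) (by norm_num)
    (by norm_num)
  obtain ⟨B₃, δ₃, hB₃, hδ₃, H3⟩ := hasMaj_entry3 (d := d) hd hL
  have hmin : min (1 / 2 : ℝ) (1 / 2) / 2 = 1 / 4 := by norm_num
  rw [hmin] at H
  refine ⟨max B B₃, min δ₀ δ₃, 1 / 4, lt_max_of_lt_left hB, lt_min hδ₀ hδ₃, by norm_num, fun i => ?_⟩
  have hx1 : (1 : ℝ) ≤ (L : ℝ) ^ i.k := one_le_pow₀ (by exact_mod_cast hL)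
  have hx0 : (0 : ℝ) < (L : ℝ) ^ i.k := lt_of_lt_of_le one_pos hx1
  have hBmax : 0 ≤ max B B₃ := (hB.le).trans (le_max_left _ _)
  have hexp : ∀ {δ : ℝ} (y y' : Tor i.Mn), min δ₀ δ₃ ≤ δ → Real.exp (-(δ * tdistT i.Mn y y')) ≤ Real.exp (-(min δ₀ δ₃ * tdistT i.Mn y y')) :=
    fun y y' hδ => Real.exp_le_exp.mpr (neg_le_neg (mul_le_mul_of_nonneg_right hδ (tdistT_nonneg _ _ _)))
  have hmono : ∀ {B' δ : ℝ} {r : ℝ}, B' ≤ max B B₃ → 0 ≤ r → r ≤ ((L : ℝ) ^ i.k) ^ (-(1 / 4 : ℝ)) → min δ₀ δ₃ ≤ δ → ∀ y y' : Tor i.Mn,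
      B' * r * Real.exp (-(δ * tdistT i.Mn y y'))
        ≤ max B B₃ * ((L : ℝ) ^ i.k) ^ (-(1 / 4 : ℝ)) * Real.exp (-(min δ₀ δ₃ * tdistT i.Mn y y')) :=
    fun hB' hr0 hr hδ y y' => mul_le_mul (mul_le_mul hB' hr hr0 hBmax) (hexp y y' hδ) (Real.exp_nonneg _)
      (mul_nonneg hBmax (Real.rpow_nonneg hx0.le _))
  have hr3 : ((L : ℝ) ^ i.k)⁻¹ ≤ ((L : ℝ) ^ i.k) ^ (-(1 / 4 : ℝ)) := by
    rw [← Real.rpow_neg_one]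
    exact Real.rpow_le_rpow_of_exponent_le hx1 (by norm_num)
  obtain ⟨h₀, h₁, h₂⟩ := H i.Mn i.dvd i.k i.m i.one_le i.ν
  have h₃ := H3 i.Mn i.dvd i.k i.m i.one_le hδ₃.le le_rfl
  refine etaRateIneq342_vec hL _ i hBmax fun n => ?_
  fin_cases n
  · exact h₀.mono (hmono (le_max_left _ _) (Real.rpow_nonneg hx0.le _) le_rfl (min_le_left _ _))
  · exact h₁.mono (hmono (le_max_left _ _) (Real.rpow_nonneg hx0.le _) le_rfl (min_le_left _ _))
  · exact h₂.mono (hmono (le_max_left _ _) (Real.rpow_nonneg hx0.le _) le_rfl (min_le_left _ _))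
  · exact h₃.mono (hmono (le_max_right _ _) (inv_nonneg.mpr hx0.le) hr3 (min_le_right _ _))

/-- The four-dimensional instance (`d + 1 = 4`) of the guard-free content. [cite: Balaban1985BackgroundPropagators, Thm 3.1 (3.42) p.397 (shape)] -/
theorem etaRateIneq342_vec_all_dim4 {L : ℕ} [NeZero L] (hL : 1 ≤ L) :
    ∃ B δ₀ γ₀ : ℝ, 0 < B ∧ 0 < δ₀ ∧ 0 < γ₀ ∧ ∀ i : VecIndex 3 L,
      EtaRateIneq342 (vecFamily hL (fun i : VecIndex 3 L => entry3 (d := 3) L i.k i.m i.Mn) i) B δ₀ γ₀ () :=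
  etaRateIneq342_vec_all (d := 3) (by norm_num) hL

end Content

end Summit.QuantumFields.YangMills.BalabanUVNodes.N15.VectorPiece

end
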